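import Literature.Probability.RandomPlanarGeometry.CritPercSLE
import Literature.Probability.RandomPlanarGeometry.SLETraceDensity
import Literature.Probability.RandomPlanarGeometry.LoewnerDerivRatio
import Literature.Probability.RandomPlanarGeometry.LoewnerTraceLimit
import Literature.Probability.RandomPlanarGeometry.SLEBoundaryHittingProofs
import Literature.Analysis.Complex.KoebeCovering
import Mathlib.Analysis.SpecialFunctions.OrdinaryHypergeometric
import Mathlib.Analysis.SpecialFunctions.Gamma.Basic
import HarnessLib

/-!
# Swallowed points of SLE_κ, `4 < κ < 8`: Rohde–Schramm's Thm 6.4 reduced to its printed lemmas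

Second layer of the decomposition of the self-touching phase **crit-perc.S20**
`Literature.Probability.RandomPlanarGeometry.ae_isSelfTouching_sleTrace` (Rohde–Schramm, Ann. Math. 161 (2005), §1 and
Thm 6.4). The first layer (`CritPercSLE.lean`, section `SelfTouching`) reduced it to the named
facts `Literature.Probability.RandomPlanarGeometry.ae_not_injective_sleTrace` (§1) and `Literature.Probability.RandomPlanarGeometry.ae_isSwallowed_sleTrace`
(Thm 6.4, first half: for `κ ∈ (4, 8)` every `z ∈ closure ℍ ∖ {0}` is a.s. swallowed, i.e.
`z ∉ γ[0, ∞)` and `τ(z) < ∞`). Here `ae_isSwallowed_sleTrace` is in turn PROVED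
(`Literature.Probability.RandomPlanarGeometry.ae_isSwallowed_sleTrace_of_lemmas`) from the lemmas its printed proof invokes
(p. 908: "Suppose that `κ ∈ (4, 8)` and `z ∈ closure ℍ`. Lemma 6.5 shows that `z ∈ ⋃ₜ Kₜ` a.s.
If `z ∈ ℍ`, then Lemma 6.3 and (6.2) show a.s. `z ∉ γ[0, ∞)`. Lemma 6.6 shows that
`1 ∉ γ[0, ∞)` a.s., and the same follows for every `z ∈ ℝ ∖ {0}` by scale and reflection
invariance."), vendored as named facts with the paper's numbering:

* `Literature.Probability.RandomPlanarGeometry.ae_swallowingTime_lt_top_of_four_lt` — **Lemma 6.5**: `κ > 4`, `z ∈ closure ℍ ∖ {0}` ⇒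
  a.s. `τ(z) < ∞`;
* `Literature.Probability.RandomPlanarGeometry.exists_tendsto_sleDerivRatio_of_lt_eight` — **Lemma 6.3, case `κ < 8`**: for `0 < κ < 8`
  and `z ∈ ℍ`, a.s. `Z(z) = lim_{t ↑ τ(z)} (Im z) |gₜ'(z)| / Im gₜ(z)` exists and is finite (the
  companion of `Literature.Probability.RandomPlanarGeometry.tendsto_sleDerivRatio_atTop_of_eight_le`, the case `κ ≥ 8`, in
  `SLETraceDensity.lean`, with the same conventions);
* `Literature.Probability.RandomPlanarGeometry.sle_measureReal_Ico_disjoint_range_eq` — **Lemma 6.6** as printed (the law (6.13) of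
  `X = inf([1, ∞) ∩ γ[0, ∞))`), vendored for the record as the statement from which the next
  item is to be discharged (not used in this file);
* `Literature.Probability.RandomPlanarGeometry.ae_sleTrace_firstHit_realRay_ne` — the consequence of Lemma 6.6 the printed proof uses
  for real points (`κ ∈ (4, 8)`, real `x ≠ 0` ⇒ a.s. the first point of the ray from `x` away
  from `0` on the trace is not `x`; "`X > 1` a.s." transported by scaling and reflection).
  **Honesty note**: this item is formally implied by the real-point half of Thm 6.4 itself, so
  that half is NOT reduced in strength here — only its deterministic topology is proved; the
  interior-point half IS reduced (to Lemma 6.3);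

together with the existence of the trace (`Literature.Probability.RandomPlanarGeometry.hasSLETrace_of_ne_eight`, RS05 Thm 5.1, already a
named fact of the prelude). The deterministic half of the argument is proved here:

* **eq. (6.2), second inequality** (p. 903: "the Koebe 1/4 theorem applied to the function
  `gₜ⁻¹ ∘ φ⁻¹` implies `Im gₜ(z₀) ≤ 2 rₜ |gₜ'(z₀)|`", `rₜ = dist(z₀, ∂Hₜ)`), in the form
  `ball z (Im gₜ(z) / (64 π |gₜ'(z)|)) ⊆ Hₜ` (`Literature.Probability.RandomPlanarGeometry.Loewner.ball_subset_domain_koebe`), from the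
  tree's PROVED Koebe covering theorem with constant `1/(128π)`
  (`Complex.ball_subset_image_of_injOn`, `Literature/Analysis/Complex/KoebeCovering.lean`) — the
  sharp constant `1/4` is irrelevant for Thm 6.4 — applied to `fₜ ∘ ψ`, where
  `ψ(u) = Re gₜ(z) + Im gₜ(z) · cayleyInvFun u` is the affine Cayley chart `𝔻 → ℍ` with
  `ψ(0) = gₜ(z)`, `|ψ'(0)| = 2 Im gₜ(z)` (reusing the tree's `Literature.Probability.RandomPlanarGeometry.cayleyInvFun`,
  `cayleyInvFun_im_pos`, `differentiableOn_cayleyInvFun`, `Literature.Probability.RandomPlanarGeometry.cayley` from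
  `CaratheodoryHalfPlane.lean` and `hasDerivAt_cayleyInvFun_zero` from
  `UpperHalfPlaneAutomorphisms.lean`), and `fₜ = gₜ⁻¹` has derivative `1/gₜ'(z)` at `gₜ(z)`
  (chain rule against `fₜ ∘ gₜ = id` near `z`; `Loewner.hasDerivAt_invFunOn_map`,
  `Loewner.differentiableOn_map`, `Loewner.bijOn_map` from `LoewnerFlow.lean`);
* the monotonicity of the ratio in `t` ((6.3), `Loewner.im_mul_norm_deriv_map_div_im_mono`,
  `LoewnerDerivRatio.lean`) turns the finite limit `Z` into the uniform bound
  `ball z (Im z / (64 π Z)) ⊆ Hₜ` for all `t < τ(z)` (`Loewner.ball_subset_domain_of_ratio_le`);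
* **interior points** (`Loewner.IsGeneratedByCurve.notMem_range_of_ball_subset_domain`): a point
  `z ∈ ℍ` with such a uniform disc is not on the generating curve — before `τ(z)` the curve
  avoids `Hₜ ⊇ ball`; after `τ(z)` it stays in `closure H_{τ(z)}`
  (`IsGeneratedByCurve.mem_closure_domain`, `LoewnerTraceLimit.lean`), and the disc, a connected
  subset of `ℍ ∖ γ[0, τ(z)]` through `z ∉ H_{τ(z)}`, misses the unbounded component `H_{τ(z)}`;
* **real points** (`Loewner.IsGeneratedByCurve.ofReal_notMem_range_of_apply_firstHit_ne`): if the
  first hit of `realRay x` is not at `x`, then `x` is never visited — before the first hitting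
  time `t₀` the curve is off the ray; after `t₀ = T_x` ("swallowing of real points is hitting of
  real rays", `Loewner.swallowingTime_ofReal_eq_firstHit_of_ne`, Lawler (2005) Rem. 6.6, proved
  in `SLEBoundaryHittingProofs.lean`) it stays in `closure H_{t₀}`, which misses `x`: a half-disc
  about `x` avoiding `γ[0, t₀]` that met the unbounded component `H_{t₀}` would lie in it, the
  disc would miss `K_{t₀}`, and `x ∉ closure K_{t₀}` would force `t₀ < T_x`
  (`Loewner.lt_swallowingTime_of_notMem_closure_hull_holds`, Lawler (2005) §4.1, proved in
  `LoewnerRealPointProofs.lean`).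

End-to-end: `Literature.Probability.RandomPlanarGeometry.ae_isSelfTouching_sleTrace_of_lemmas` derives the self-touching phase
from `ae_not_injective_sleTrace` (§1), Thm 5.1, Lemma 6.5, Lemma 6.3 (`κ < 8`) and the first-hit
consequence of Lemma 6.6. What a full discharge still needs: those facts (Itô calculus for the
Bessel-type flows, optional stopping, the SLE Markov property, reflection invariance of the SLE
law; none in the tree or Mathlib), the real-point half of Thm 6.4 remaining, in strength, a
vendored fact (see the honesty note above).

## Mathlib

We USE `Function.invFunOn`, `HasDerivAt.comp` / `HasDerivAt.unique` /
`HasDerivAt.congr_of_eventuallyEq` (derivative of the inverse map), `Convex.isPreconnected`,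
`convex_halfSpace_im_gt`, `IsPreconnected.subset_connectedComponentIn`, `connectedComponentIn_eq`,
`map_mem_closure`, `closure_Iio'`, `Monotone.ge_of_tendsto`, `Metric.ball`,
`ordinaryHypergeometric` (`₂F₁`), `Real.Gamma`. Mathlib has no Loewner chains / SLE and no Koebe
theorem (searched `Koebe`, `Loewner`). From the tree we reuse the Cayley transform API of
`CaratheodoryHalfPlane.lean` / `UpperHalfPlaneAutomorphisms.lean` (no new chart is defined) and
the `firstHit` / `realRay` API of `SLEBoundaryHitting.lean`.

## References

* S. Rohde, O. Schramm, *Basic properties of SLE*, Ann. of Math. 161 (2005) 883–924: §2.1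
  (p. 886, `τ(z)`), Lemma 6.3 and eq. (6.2) (p. 903), Thm 6.4 and Lemma 6.5 (p. 906), Lemma 6.6,
  eq. (6.13) and the proof of Thm 6.4 (p. 908).
* G. F. Lawler, *Conformally Invariant Processes in the Plane*, AMS (2005), Thm. 3.17 (Koebe),
  Ch. 4 §4.1 (the maps `gₜ : Hₜ → ℍ`, real points p. 96), Rem. 6.6 (p. 148), Prop. 6.10 (pp. 150–151).
-/

noncomputable section

open Set Filter Topology MeasureTheory Metric Bornology Complex
open UpperHalfPlane (upperHalfPlaneSet isOpen_upperHalfPlaneSet)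
open scoped NNReal Real

namespace Literature.Probability.RandomPlanarGeometry

namespace Loewner

/-! ### The affine Cayley chart of `ℍ` centred at a point -/

/-- The derivative at `0` of the affine Cayley chart `u ↦ a + b · cayleyInvFun u`
(`cayleyInvFun u = i(1 + u)/(1 - u)`, `CaratheodoryHalfPlane.lean`;
`hasDerivAt_cayleyInvFun_zero`, `UpperHalfPlaneAutomorphisms.lean`) is `2 i b`. [folklore] -/
theorem hasDerivAt_affine_cayleyInvFun_zero (a b : ℂ) :
    HasDerivAt (fun u ↦ a + b * cayleyInvFun u) (b * (2 * I)) 0 :=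
  (hasDerivAt_cayleyInvFun_zero.const_mul b).const_add a

/-- For real `a` and positive real `b`, the affine Cayley chart maps the unit disc into `ℍ`
(`cayleyInvFun_im_pos`). [folklore] -/
theorem mapsTo_affine_cayleyInvFun (a : ℝ) {b : ℝ} (hb : 0 < b) :
    MapsTo (fun u ↦ (a : ℂ) + (b : ℂ) * cayleyInvFun u) (ball 0 1) upperHalfPlaneSet := by
  intro u hu
  show 0 < ((a : ℂ) + (b : ℂ) * cayleyInvFun u).im
  rw [add_im, ofReal_im, zero_add, mul_im, ofReal_re, ofReal_im, zero_mul, add_zero]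
  exact mul_pos hb (cayleyInvFun_im_pos (mem_ball_zero_iff.1 hu))

/-- The affine Cayley chart is holomorphic on the unit disc (`differentiableOn_cayleyInvFun`).
[folklore] -/
theorem differentiableOn_affine_cayleyInvFun (a b : ℂ) :
    DifferentiableOn ℂ (fun u ↦ a + b * cayleyInvFun u) (ball 0 1) := by
  have h : DifferentiableOn ℂ cayleyInvFun (ball 0 1) :=
    differentiableOn_cayleyInvFun.mono fun u hu h1 ↦ by
      rw [h1, mem_ball_zero_iff, norm_one] at hu
      exact lt_irrefl _ hu
  exact (differentiableOn_const a).add ((differentiableOn_const b).mul h)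

/-- The affine Cayley chart with `b ≠ 0` is injective on the unit disc (`cayley.symm` is).
[folklore] -/
theorem injOn_affine_cayleyInvFun (a : ℂ) {b : ℂ} (hb : b ≠ 0) :
    InjOn (fun u ↦ a + b * cayleyInvFun u) (ball 0 1) := by
  intro u hu v hv h
  have h' : cayleyInvFun u = cayleyInvFun v := mul_left_cancel₀ hb (add_left_cancel h)
  exact cayley.symm.injOn hu hv (by simpa using h')

/-! ### Eq. (6.2), second inequality, via Koebe covering -/

variable {W : ℝ≥0 → ℝ}

/-- **A Koebe disc about `z` inside `Hₜ`** (Rohde–Schramm (2005), p. 903: "the Koebe 1/4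
theorem applied to the function `gₜ⁻¹ ∘ φ⁻¹` implies `Im gₜ(z₀) ≤ 2 rₜ |gₜ'(z₀)|`",
`rₜ = dist(z₀, ∂Hₜ)`), with the tree's proved Koebe covering constant `1/(128π)`
(`Complex.ball_subset_image_of_injOn`) in place of `1/4`: for a continuous driving function and
`z ∈ Hₜ`, the disc about `z` of radius `Im gₜ(z) / (64 π |gₜ'(z)|)` lies in `Hₜ`. The univalent
map is `fₜ ∘ ψ`, `ψ(u) = Re gₜ(z) + Im gₜ(z) · cayleyInvFun u` the affine Cayley chart of `ℍ`
(`Literature.Probability.RandomPlanarGeometry.cayleyInvFun`, `CaratheodoryHalfPlane.lean`) with `ψ(0) = gₜ(z)`, `|ψ'(0)| = 2 Im gₜ(z)`,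
and `fₜ = gₜ⁻¹` (`Function.invFunOn (map W t) (domain W t)`), whose derivative at `gₜ(z)` is
`1/gₜ'(z)`. [cite: RohdeSchramm2005, eq. (6.2)] -/
theorem ball_subset_domain_koebe (hW : Continuous W) {t : ℝ≥0} {z : ℂ} (hz : z ∈ domain W t) :
    ball z ((map W t z).im / (64 * π * ‖deriv (map W t) z‖)) ⊆ domain W t := by
  set w₀ : ℂ := map W t z with hw₀
  have hy₀ : 0 < w₀.im := mapsTo_map hW t hz
  set F : ℂ → ℂ := Function.invFunOn (map W t) (domain W t) with hF
  have hFbij := bijOn_invFunOn_map hW t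
  have hFz : F w₀ = z := (bijOn_map hW t).invOn_invFunOn.1 hz
  -- derivative of `F` at `w₀` is the inverse of `gₜ'(z)`
  obtain ⟨F', -, hF'⟩ := hasDerivAt_invFunOn_map hW t hy₀
  have hg : HasDerivAt (map W t) (deriv (map W t) z) z :=
    ((differentiableOn_map hW t).differentiableAt ((isOpen_domain hW t).mem_nhds hz)).hasDerivAt
  have hcomp : HasDerivAt (F ∘ map W t) (F' * deriv (map W t) z) z := by
    have hF'' : HasDerivAt F F' (map W t z) := hF'
    exact hF''.comp z hg
  have hid : HasDerivAt (F ∘ map W t) 1 z := by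
    refine (hasDerivAt_id z).congr_of_eventuallyEq ?_
    filter_upwards [(isOpen_domain hW t).mem_nhds hz] with p hp
    exact (bijOn_map hW t).invOn_invFunOn.1 hp
  have hprod : F' * deriv (map W t) z = 1 := hcomp.unique hid
  -- the univalent map `f = F ∘ ψ` on the unit disc
  set ψ : ℂ → ℂ := fun u ↦ ((w₀.re : ℝ) : ℂ) + ((w₀.im : ℝ) : ℂ) * cayleyInvFun u with hψ
  have hψ0 : ψ 0 = w₀ := by
    simp only [hψ, cayleyInvFun_zero]
    exact Complex.ext (by simp) (by simp)
  have hψmaps : MapsTo ψ (ball 0 1) upperHalfPlaneSet := mapsTo_affine_cayleyInvFun w₀.re hy₀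
  have hfd : DifferentiableOn ℂ (F ∘ ψ) (ball 0 1) :=
    (differentiableOn_invFunOn_map hW t).comp (differentiableOn_affine_cayleyInvFun _ _) hψmaps
  have hfinj : InjOn (F ∘ ψ) (ball 0 1) :=
    hFbij.injOn.comp (injOn_affine_cayleyInvFun _ (by exact_mod_cast hy₀.ne')) hψmaps
  have hK := Complex.ball_subset_image_of_injOn hfd hfinj
  have hf0 : (F ∘ ψ) 0 = z := by
    show F (ψ 0) = z
    rw [hψ0, hFz]
  have hfder : deriv (F ∘ ψ) 0 = F' * ((w₀.im : ℂ) * (2 * I)) := by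
    have h1 : HasDerivAt ψ ((w₀.im : ℂ) * (2 * I)) 0 := hasDerivAt_affine_cayleyInvFun_zero _ _
    have h2 : HasDerivAt F F' (ψ 0) := by rw [hψ0]; exact hF'
    exact (h2.comp 0 h1).deriv
  -- the Koebe radius equals `Im gₜ(z) / (64 π |gₜ'(z)|)`
  have hnorm : ‖deriv (F ∘ ψ) 0‖ / (128 * π) = w₀.im / (64 * π * ‖deriv (map W t) z‖) := by
    rw [hfder, norm_mul, norm_mul, norm_mul, Complex.norm_real, Complex.norm_I,
      Real.norm_of_nonneg hy₀.le]
    have hn : ‖F'‖ * ‖deriv (map W t) z‖ = 1 := by rw [← norm_mul, hprod, norm_one]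
    have hD : ‖deriv (map W t) z‖ ≠ 0 := fun h ↦ by rw [h, mul_zero] at hn; exact zero_ne_one hn
    have hF'eq : ‖F'‖ = ‖deriv (map W t) z‖⁻¹ := eq_inv_of_mul_eq_one_left hn
    rw [hF'eq]
    field_simp
    norm_num
  rw [hf0, hnorm] at hK
  refine hK.trans ?_
  rintro _ ⟨u, hu, rfl⟩
  exact hFbij.mapsTo (hψmaps hu)


/-- **Eq. (6.2), second inequality, in the form used for `κ < 8`**: if the Rohde–Schramm ratio
`(Im z) |gₜ'(z)| / Im gₜ(z)` is at most `M` at a time `t < T_z` (`z ∈ ℍ`), then the disc about `z`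
of radius `Im z / (64 π M)` lies in `Hₜ` (Rohde–Schramm (2005), p. 903:
"`Z(z₀)⁻¹ Im z₀ / 2 ≤ dist(z₀, γ[0,∞) ∪ ℝ)`", here with the proved Koebe constant `1/(128π)` in
place of `1/4`). From `ball_subset_domain_koebe`. [cite: RohdeSchramm2005, eq. (6.2)] -/
theorem ball_subset_domain_of_ratio_le (hW : Continuous W) {t : ℝ≥0} {z : ℂ} (hz : 0 < z.im)
    (ht : (t : WithTop ℝ≥0) < swallowingTime W z) {M : ℝ}
    (hM : z.im * ‖deriv (map W t) z‖ / (map W t z).im ≤ M) :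
    ball z (z.im / (64 * π * M)) ⊆ domain W t := by
  have hzdom : z ∈ domain W t := (mem_domain_iff W t z).2 ⟨hz, ht⟩
  have hy : 0 < (map W t z).im := mapsTo_map hW t hzdom
  have h1 : 1 ≤ z.im * ‖deriv (map W t) z‖ / (map W t z).im :=
    one_le_im_mul_norm_deriv_map_div_im hW hz ht
  have hM1 : 1 ≤ M := h1.trans hM
  have hM0 : 0 < M := one_pos.trans_le hM1
  have hD : 0 < ‖deriv (map W t) z‖ := by
    refine lt_of_not_ge fun hD ↦ ?_
    have : z.im * ‖deriv (map W t) z‖ / (map W t z).im ≤ 0 :=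
      div_nonpos_of_nonpos_of_nonneg (mul_nonpos_of_nonneg_of_nonpos hz.le hD) hy.le
    linarith
  refine (ball_subset_ball ?_).trans (ball_subset_domain_koebe hW hzdom)
  -- `Im z / (64 π M) ≤ Im gₜ(z) / (64 π |gₜ'(z)|)` since `Im z |gₜ'(z)| ≤ M Im gₜ(z)`
  rw [div_le_iff₀ hy] at hM
  rw [div_le_div_iff₀ (by positivity) (by positivity)]
  nlinarith [Real.pi_pos]

/-! ### A point with a uniform Koebe disc is never visited by the generating curve -/

variable {γ : ℝ≥0 → ℂ}

/-- **A point `z ∈ ℍ` about which a fixed disc stays inside `Hₜ` for all `t < T_z` is not on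
the generating curve.** For `t < T_z` the curve avoids the disc (`γ[0, t] ∩ Hₜ = ∅`); if
`T_z < ∞`, the disc (a connected subset of `ℍ ∖ γ[0, T_z]` containing `z ∉ H_{T_z}`) is disjoint
from the unbounded component `H_{T_z}`, while `γ s ∈ closure H_{T_z}` for `s ≥ T_z`
(`IsGeneratedByCurve.mem_closure_domain`). This is the step "therefore, since
`lim_{t ↑ τ(z₀)} rₜ = dist(z₀, γ[0, ∞) ∪ ℝ)`" of Rohde–Schramm (2005), p. 903, in the direction
needed for Thm 6.4. [cite: RohdeSchramm2005, eq. (6.2)] -/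
theorem IsGeneratedByCurve.notMem_range_of_ball_subset_domain (hγ : IsGeneratedByCurve W γ)
    (hW : Continuous W) {z : ℂ} (hz : 0 < z.im) {ρ : ℝ} (hρ : 0 < ρ)
    (hball : ∀ t : ℝ≥0, (t : WithTop ℝ≥0) < swallowingTime W z → ball z ρ ⊆ domain W t) :
    z ∉ range γ := by
  rintro ⟨s, hs⟩
  -- before `T_z` the curve avoids the disc
  have hav : ∀ r : ℝ≥0, (r : WithTop ℝ≥0) < swallowingTime W z → γ r ∉ ball z ρ := by
    intro r hr hmem
    exact (hγ.domain_subset_diff r (hball r hr hmem)).2 ⟨r, ⟨zero_le, le_rfl⟩, rfl⟩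
  -- `z = γ s ∈ γ[0, s]`, so `z ∉ Hₛ` and `T_z ≤ s`
  have hτs : swallowingTime W z ≤ s := by
    refine le_of_not_gt fun h ↦ hav s h ?_
    rw [hs]
    exact mem_ball_self hρ
  obtain ⟨τ₀, hτ₀⟩ : ∃ τ₀ : ℝ≥0, swallowingTime W z = τ₀ :=
    Option.ne_none_iff_exists'.1 (ne_top_of_le_ne_top WithTop.coe_ne_top hτs)
  have hτ₀s : τ₀ ≤ s := by rw [hτ₀] at hτs; exact_mod_cast hτs
  have hzW : z ≠ W 0 := by
    intro h
    have : z.im = 0 := by rw [h, Complex.ofReal_im]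
    exact hz.ne' this
  have hτ₀pos : 0 < τ₀ := by
    have h0 := swallowingTime_pos_holds hW hzW
    rw [hτ₀] at h0
    exact_mod_cast h0
  -- the curve avoids the disc on `[0, τ₀]` (at `τ₀` by continuity from the left)
  have hav' : ∀ r : ℝ≥0, r ≤ τ₀ → γ r ∉ ball z ρ := by
    intro r hr
    rcases hr.lt_or_eq with hlt | rfl
    · exact hav r (by rw [hτ₀]; exact_mod_cast hlt)
    · have hmaps : MapsTo γ (Iio r) (ball z ρ)ᶜ := fun u hu ↦
        hav u (by rw [hτ₀]; exact_mod_cast hu)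
      have hcl : r ∈ closure (Iio r) := by
        rw [closure_Iio' (show (Iio (r : ℝ≥0)).Nonempty from ⟨0, hτ₀pos⟩)]
        exact self_mem_Iic
      have := map_mem_closure hγ.continuous hcl hmaps
      rwa [isOpen_ball.isClosed_compl.closure_eq] at this
  -- the disc lies in `U = ℍ ∖ γ[0, τ₀]`
  set U : Set ℂ := upperHalfPlaneSet \ γ '' Icc 0 τ₀ with hU_def
  have hU : ball z ρ ⊆ U := by
    intro p hp
    refine ⟨domain_subset W 0 (hball 0 (by rw [hτ₀]; exact_mod_cast hτ₀pos) hp), ?_⟩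
    rintro ⟨r, hr, rfl⟩
    exact hav' r hr.2 hp
  -- the disc is disjoint from `H_{τ₀}` (else `z ∈ H_{τ₀}`, i.e. `τ₀ < T_z`)
  have hdisj : ∀ p ∈ ball z ρ, p ∉ domain W τ₀ := by
    intro p hp hpdom
    rw [hγ.domain_eq] at hpdom
    have hsub : ball z ρ ⊆ connectedComponentIn U z :=
      (convex_ball z ρ).isPreconnected.subset_connectedComponentIn (mem_ball_self hρ) hU
    have heq : connectedComponentIn U z = connectedComponentIn U p :=
      connectedComponentIn_eq (hsub hp)
    have hzdom : z ∈ domain W τ₀ := by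
      rw [hγ.domain_eq]
      exact ⟨hU (mem_ball_self hρ), heq ▸ hpdom.2⟩
    have := ((mem_domain_iff W τ₀ z).1 hzdom).2
    rw [hτ₀] at this
    exact lt_irrefl _ this
  -- but `γ s ∈ closure H_{τ₀}` and `γ s = z` lies in the open disc
  have hcl : z ∈ closure (domain W τ₀) := hs ▸ hγ.mem_closure_domain hW hτ₀s
  rw [_root_.mem_closure_iff] at hcl
  obtain ⟨p, hp, hpdom⟩ := hcl (ball z ρ) isOpen_ball (mem_ball_self hρ)
  exact hdisj p hp hpdom

/-! ### A real point first hit strictly inside its ray is never visited -/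

/-- **A real point first hit strictly inside its ray is never visited.** For a chain generated
by `γ` with continuous driving function started at `0` and a real `x ≠ 0`: if at the first
hitting time `t₀` of the closed ray `realRay x` (from `x` away from `0`) the curve is not at `x`
itself, then `x ∉ γ[0, ∞)`. Before `t₀` the curve is off the ray; at `t₀` it is at
`γ t₀ ≠ x`; and after `t₀ = T_x` (`swallowingTime_ofReal_eq_firstHit_of_ne`, Lawler (2005),
Rem. 6.6) it stays in `closure H_{t₀}` (`IsGeneratedByCurve.mem_closure_domain`), which misses
`x`: a half-disc `ball x ρ ∩ ℍ` avoiding `γ[0, t₀]` is connected, so if it met the unbounded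
component `H_{t₀}` of `ℍ ∖ γ[0, t₀]` it would lie in it, `ball x ρ` would miss `K_{t₀}`, and
`x ∉ closure K_{t₀}` would give `t₀ < T_x` (`lt_swallowingTime_of_notMem_closure_hull_holds`,
Lawler (2005), §4.1). This is the topological content of "`z` is swallowed: `z ∉ γ[0, ∞)` but
`z ∈ K_t`" for real `z` in Rohde–Schramm (2005), Thm 6.4 (p. 906) and of Lawler (2005),
proof of Prop. 6.10 ("`γ(T_1)` is the largest real `x` with `T_x = T_1`", p. 151).
[cite: RohdeSchramm2005, Thm 6.4] -/
theorem IsGeneratedByCurve.ofReal_notMem_range_of_apply_firstHit_ne (hγ : IsGeneratedByCurve W γ)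
    (hW : Continuous W) (hW0 : W 0 = 0) {x : ℝ} (hx : x ≠ 0)
    (hne : ∀ t₀ : ℝ≥0, firstHit γ (realRay x) = t₀ → γ t₀ ≠ x) :
    (x : ℂ) ∉ range γ := by
  rintro ⟨s, hs⟩
  have hxray : (x : ℂ) ∈ realRay x := ofReal_mem_realRay x
  -- the ray is hit (at time `s` at the latest), first at a time `t₀ ≤ s` with `γ t₀ ≠ x`
  have hfin : firstHit γ (realRay x) ≠ ⊤ :=
    ne_top_of_le_ne_top WithTop.coe_ne_top (firstHit_le (hs.symm ▸ hxray))
  obtain ⟨t₀, ht₀, hγt₀⟩ := exists_firstHit_eq_coe hγ.continuous (isClosed_realRay x) hfin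
  have hne₀ : γ t₀ ≠ x := hne t₀ ht₀
  -- `x ∉ γ[0, t₀]`
  have hnot : ∀ r : ℝ≥0, r ≤ t₀ → γ r ≠ x := by
    intro r hr
    rcases hr.lt_or_eq with hlt | rfl
    · intro h
      refine notMem_of_lt_firstHit (γ := γ) (S := realRay x) (t := r) ?_ (h.symm ▸ hxray)
      rw [ht₀]
      exact_mod_cast hlt
    · exact hne₀
  have ht₀s : t₀ < s := by
    refine lt_of_not_ge fun h ↦ hnot s h hs
  -- `T_x = t₀`
  have hT : swallowingTime W x = t₀ := by
    rw [swallowingTime_ofReal_eq_firstHit_of_ne hW hW0 hγ hx, ht₀]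
  -- a disc about `x` missing the compact set `γ[0, t₀]`
  have hxK : (x : ℂ) ∉ γ '' Icc 0 t₀ := by
    rintro ⟨r, hr, hrx⟩
    exact hnot r hr.2 hrx
  obtain ⟨ρ, hρ, hball⟩ : ∃ ρ > 0, Disjoint (ball (x : ℂ) ρ) (γ '' Icc 0 t₀) := by
    have hcl : IsClosed (γ '' Icc 0 t₀) := (isCompact_Icc.image hγ.continuous).isClosed
    have hopen : (γ '' Icc 0 t₀)ᶜ ∈ 𝓝 (x : ℂ) := hcl.isOpen_compl.mem_nhds hxK
    obtain ⟨ρ, hρ, hsub⟩ := Metric.mem_nhds_iff.1 hopen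
    exact ⟨ρ, hρ, disjoint_left.2 fun p hp hpK ↦ hsub hp hpK⟩
  -- the half-disc `B⁺ = ball x ρ ∩ ℍ` lies in `U = ℍ ∖ γ[0, t₀]` and is connected
  set U : Set ℂ := upperHalfPlaneSet \ γ '' Icc 0 t₀ with hU_def
  set B : Set ℂ := ball (x : ℂ) ρ ∩ upperHalfPlaneSet with hB_def
  have hBU : B ⊆ U := fun p hp ↦ ⟨hp.2, disjoint_left.1 hball hp.1⟩
  have hBconn : IsPreconnected B :=
    ((convex_ball (x : ℂ) ρ).inter (convex_halfSpace_im_gt 0)).isPreconnected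
  -- `B⁺` misses `H_{t₀}`
  have hxW : (x : ℂ) ≠ W 0 := by rw [hW0]; exact_mod_cast hx
  have hdisj : ∀ p ∈ B, p ∉ domain W t₀ := by
    intro p hp hpdom
    -- then all of `B⁺` is in `H_{t₀}`
    have hBdom : B ⊆ domain W t₀ := by
      intro q hq
      rw [hγ.domain_eq] at hpdom ⊢
      have hpq : connectedComponentIn U p = connectedComponentIn U q :=
        connectedComponentIn_eq (hBconn.subset_connectedComponentIn hp hBU hq)
      exact ⟨hBU hq, hpq ▸ hpdom.2⟩
    -- so the disc misses the hull, `x ∉ closure K_{t₀}`, and `t₀ < T_x = t₀`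
    have hxcl : (x : ℂ) ∉ closure (hull W t₀) := by
      rw [_root_.mem_closure_iff]
      push Not
      refine ⟨ball (x : ℂ) ρ, isOpen_ball, mem_ball_self hρ, ?_⟩
      refine Set.eq_empty_of_forall_notMem fun q ⟨hq, hqK⟩ ↦ ?_
      exact (hBdom ⟨hq, hull_subset W t₀ hqK⟩).2 hqK
    have := lt_swallowingTime_of_notMem_closure_hull_holds hW hxW hxcl
    rw [hT] at this
    exact lt_irrefl _ this
  -- hence `x ∉ closure H_{t₀}`, contradicting `γ s ∈ closure H_{t₀}`, `γ s = x`
  have hcl : (x : ℂ) ∈ closure (domain W t₀) := hs ▸ hγ.mem_closure_domain hW ht₀s.le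
  rw [_root_.mem_closure_iff] at hcl
  obtain ⟨p, hp, hpdom⟩ := hcl (ball (x : ℂ) ρ) isOpen_ball (mem_ball_self hρ)
  exact hdisj p ⟨hp, domain_subset W t₀ hpdom⟩ hpdom

end Loewner

/-! ### The printed lemmas behind Rohde–Schramm's Thm 6.4 (first half), as named facts -/

/-- **Rohde–Schramm (2005), Lemma 6.5** (p. 906): "Let `z ∈ closure ℍ ∖ {0}`. If `κ > 4`, then
`P[τ(z) < ∞] = 1`." Here `τ(z)` (§2.1, p. 886: "the first time `τ` such that `0` is a limit point
of `gₜ(z) - ξ(t)` as `t ↑ τ`", for every `z ∈ closure ℍ ∖ {0}`, real points included) is the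
lifetime of the Loewner flow (2.1) started at `z`, `Loewner.swallowingTime (sleDriving κ ω) z`, on
the canonical space `(ℝ≥0 → ℝ, preWienerMeasure)` with driving function `√κ B`. Printed proof: the
local martingale `h(gₜ(z) - ξ(t))`, `h(z) = Im(θ z^b)`, `b = 1 - 4/κ`, "sprint times" of the
Brownian motion and optional sampling. (The stronger "a.s. for all `z`" version stated after the
lemma rests on Thm 7.1 and is not vendored.) Cross-reference: for real `x > 0` this overlaps the
tree's `Literature.Probability.RandomPlanarGeometry.sle_swallowingTime_ofReal_lt_top` (Lawler (2005), Prop. 6.8, "a.s. for all `x > 0`",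
`SLEBoundaryHitting.lean`); interior points and `x < 0` are covered only here.
[cite: RohdeSchramm2005, Lemma 6.5] -/
def ae_swallowingTime_lt_top_of_four_lt : Prop :=
  ∀ {κ : ℝ≥0}, 4 < κ → ∀ {z : ℂ}, 0 ≤ z.im → z ≠ 0 →
    ∀ᵐ ω ∂Process.preWienerMeasure, Loewner.swallowingTime (sleDriving κ ω) z < ⊤

/-- **Rohde–Schramm (2005), Lemma 6.3, the case `κ < 8`** (p. 903): "Let `κ > 0` and
`z = x + iy ∈ ℍ`. Then the limit `Z(z) := lim_{t ↑ τ(z)} y |gₜ'(z)| / Im(gₜ(z))` exists a.s. We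
have `Z(z) = ∞` a.s. if `κ ≥ 8` and `Z(z) < ∞` a.s. if `κ < 8`." Vendored, complementing
`tendsto_sleDerivRatio_atTop_of_eight_le` (the case `κ ≥ 8`, `SLETraceDensity.lean`) with the same
conventions: for `0 < κ < 8` and `z ∈ ℍ`, almost surely the ratio `sleDerivRatio κ ω z t` converges
to a (finite) real limit as `t` increases to `τ(z) = Loewner.swallowingTime (sleDriving κ ω) z`
through `[0, τ(z))` (the filter `atTop` of `{t | ↑t < τ(z)}`; `τ(z) = ⊤` allowed). The hypothesis
`κ > 0` of the lemma matters here: for `κ = 0` the trace `t ↦ 2i√t` passes through `z = iy` and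
`Z(iy) = ∞`. Printed proof: the martingale `Mₜ = (ŷ |gₜ'(ẑ)| / yₜ)^a Ĝ(zₜ)` with `Ĝ`
hypergeometric, and `inf Ĝ > 0` ((6.7)–(6.10)) for `a < 1 - κ/8`. [cite: RohdeSchramm2005, Lemma 6.3] -/
def exists_tendsto_sleDerivRatio_of_lt_eight : Prop :=
  ∀ {κ : ℝ≥0}, 0 < κ → κ < 8 → ∀ z ∈ upperHalfPlaneSet, ∀ᵐ ω ∂Process.preWienerMeasure,
    ∃ Z : ℝ, Tendsto
      (fun t : {t : ℝ≥0 // (t : WithTop ℝ≥0) < Loewner.swallowingTime (sleDriving κ ω) z} ↦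
        sleDerivRatio κ ω z t)
      atTop (𝓝 Z)

/-- **Rohde–Schramm (2005), Lemma 6.6** (p. 908), as printed: "Fix `κ ∈ (4, 8)` and let
`X := inf([1, ∞) ∩ γ[0, ∞))`. Then for all `s ≥ 1`,
`P[X ≥ s] = 4^{(κ-4)/κ} √π ₂F₁(1 - 4/κ, 2 - 8/κ, 2 - 4/κ, 1/s) s^{(4-κ)/κ} / (Γ(2 - 4/κ) Γ(4/κ - 1/2))`"
(eq. (6.13); "a variant of Cardy's formula", equivalent to it for `κ = 6`). Here `₂F₁` is the
series (6.1), Mathlib's `ordinaryHypergeometric`, and the event `{X ≥ s}` (with `inf ∅ = ∞`) is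
written out as "no real `y ∈ [1, s)` is on the trace". Sanity of the transcription: at `s = 1` the
right-hand side is `1` (Gauss's summation `₂F₁(a, b; c; 1) = Γ(c)Γ(c-a-b)/(Γ(c-a)Γ(c-b))`,
`c - a - b = 8/κ - 1 > 0`, and the duplication formula), and it tends to `0` as `s → ∞`, as the
printed proof notes ("zero when `s = ∞` and is `1` when `s = 1`"). Printed proof: the local
martingale obtained by substituting `1/Yₜ`, `Yₜ = (gₜ(1) - ξ(t))/(gₜ(s) - ξ(t))`, for `s` in
(6.13), optional sampling, and `P[X = s'] = 0` by scale invariance. This is the printed statement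
from which the consequence item `ae_sleTrace_firstHit_realRay_ne` below is to be discharged; it
is not used in this file. [cite: RohdeSchramm2005, Lemma 6.6] -/
def sle_measureReal_Ico_disjoint_range_eq : Prop :=
  ∀ {κ : ℝ≥0}, 4 < κ → κ < 8 → ∀ {s : ℝ}, 1 ≤ s →
    Process.preWienerMeasure.real
        {ω | ∀ y : ℝ, 1 ≤ y → y < s → (y : ℂ) ∉ range (sleTrace κ ω)} =
      (4 : ℝ) ^ (((κ : ℝ) - 4) / κ) * Real.sqrt π *
          ₂F₁ (1 - 4 / (κ : ℝ)) (2 - 8 / (κ : ℝ)) (2 - 4 / (κ : ℝ)) (1 / s) *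
          s ^ ((4 - (κ : ℝ)) / κ) /
        (Real.Gamma (2 - 4 / (κ : ℝ)) * Real.Gamma (4 / (κ : ℝ) - 1 / 2))

/-- **The first point of a real ray on the SLE_κ trace is a.s. not its endpoint, `4 < κ < 8`**
(Rohde–Schramm (2005), proof of Thm 6.4, p. 908: "Lemma 6.6 shows that `1 ∉ γ[0, ∞)` a.s., and
the same follows for every `z ∈ ℝ ∖ {0}` by scale and reflection invariance"): for a real
`x ≠ 0`, almost surely, if the trace hits the closed ray `realRay x` from `x` away from `0`, first
at time `t₀`, then `γ(t₀) ≠ x`. For `x = 1` this is "`X > 1` a.s.", `X = inf([1, ∞) ∩ γ[0, ∞))`,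
which follows from Lemma 6.6 (`sle_measureReal_Ico_disjoint_range_eq`: `P[X ≥ s] → 1` as `s ↓ 1`,
the right-hand side of (6.13) being continuous and equal to `1` at `s = 1`); the general `x` is
obtained by scale invariance (`x > 0`) and reflection invariance (`x < 0`) of the law of the
trace. **Status (honesty note).** This consequence item is the probabilistic input of the
real-point half of Thm 6.4 and is formally implied by that half (`CritPerc.ae_isSwallowed_sleTrace`
gives `x ∉ γ[0, ∞)` outright): the real-point half is thus NOT reduced to a weaker statement here;
what this file adds for real points is the deterministic passage from "first hit not at `x`" to
"`x` never visited" (`Loewner.IsGeneratedByCurve.ofReal_notMem_range_of_apply_firstHit_ne`). The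
discharge route is Lemma 6.6 as printed (vendored above) + continuity of (6.13) at `s = 1` +
scaling (`identDistrib_sleTrace_scale_of_hasSLETrace`, tree) + reflection invariance of the SLE
law (not in the tree). [cite: RohdeSchramm2005, Lemma 6.6 and Thm 6.4 (proof, p. 908)] -/
def ae_sleTrace_firstHit_realRay_ne : Prop :=
  ∀ {κ : ℝ≥0}, 4 < κ → κ < 8 → ∀ {x : ℝ}, x ≠ 0 →
    ∀ᵐ ω ∂Process.preWienerMeasure, ∀ t₀ : ℝ≥0,
      firstHit (sleTrace κ ω) (realRay x) = t₀ → sleTrace κ ω t₀ ≠ x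

/-! ### Assembly -/

/-- **Real points are a.s. not on the trace, `4 < κ < 8`** (Rohde–Schramm (2005), proof of
Thm 6.4, p. 908: "... `1 ∉ γ[0, ∞)` a.s., and the same follows for every `z ∈ ℝ ∖ {0}`"), from
the first-hit fact `ae_sleTrace_firstHit_realRay_ne` (hypothesis `hX`) and the existence of the
trace (`hasSLETrace_of_ne_eight`, RS05 Thm 5.1, `hT`); the topology is proved
(`Loewner.IsGeneratedByCurve.ofReal_notMem_range_of_apply_firstHit_ne`).
[cite: RohdeSchramm2005, Thm 6.4 (proof, p. 908)] -/
theorem ae_ofReal_notMem_range_sleTrace_of_firstHit_ne (hT : hasSLETrace_of_ne_eight)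
    (hX : ae_sleTrace_firstHit_realRay_ne) {κ : ℝ≥0} (hκ : 4 < κ) (hκ' : κ < 8) {x : ℝ}
    (hx : x ≠ 0) : ∀ᵐ ω ∂Process.preWienerMeasure, (x : ℂ) ∉ range (sleTrace κ ω) := by
  filter_upwards [ae_isGeneratedByCurve_sleTrace (hT hκ'.ne), hX hκ hκ' hx] with ω hg hne
  exact hg.ofReal_notMem_range_of_apply_firstHit_ne (continuous_sleDriving κ ω)
    (sleDriving_zero κ ω) hx hne

/-- **Points of `ℍ` with `Z(z) < ∞` are not on the trace** (Rohde–Schramm (2005), proof of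
Thm 6.4: "If `z ∈ ℍ`, then Lemma 6.3 and (6.2) show a.s. `z ∉ γ[0, ∞)`", p. 908), pathwise form:
if the SLE_κ chain of the sample path `ω` is generated by its trace and the ratio
`(Im z) |gₜ'(z)| / Im gₜ(z)` has a finite limit `Z` as `t ↑ τ(z)`, then `z` is not on the trace.
The ratio is non-decreasing in `t` ((6.3), `Loewner.im_mul_norm_deriv_map_div_im_mono`), so it is
bounded by `Z`; by the Koebe bound (`Loewner.ball_subset_domain_of_ratio_le`) the disc about `z`
of radius `Im z / (64 π Z)` lies in every `Hₜ`, `t < τ(z)`, and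
`Loewner.IsGeneratedByCurve.notMem_range_of_ball_subset_domain` concludes.
[cite: RohdeSchramm2005, Thm 6.4 (proof, p. 908)] -/
theorem notMem_range_sleTrace_of_tendsto_sleDerivRatio {κ : ℝ≥0} {ω : ℝ≥0 → ℝ}
    (hg : Loewner.IsGeneratedByCurve (sleDriving κ ω) (sleTrace κ ω)) {z : ℂ} (hz : 0 < z.im)
    {Z : ℝ} (hZ : Tendsto
      (fun t : {t : ℝ≥0 // (t : WithTop ℝ≥0) < Loewner.swallowingTime (sleDriving κ ω) z} ↦
        sleDerivRatio κ ω z t) atTop (𝓝 Z)) :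
    z ∉ range (sleTrace κ ω) := by
  have hW : Continuous (sleDriving κ ω) := continuous_sleDriving κ ω
  -- the ratio is monotone along `[0, τ(z))`, hence bounded by its limit `Z`
  have hmono : Monotone
      (fun t : {t : ℝ≥0 // (t : WithTop ℝ≥0) < Loewner.swallowingTime (sleDriving κ ω) z} ↦
        sleDerivRatio κ ω z t) := fun s t hst ↦
    Loewner.im_mul_norm_deriv_map_div_im_mono hW hz hst t.2
  have hle : ∀ t : ℝ≥0, (t : WithTop ℝ≥0) < Loewner.swallowingTime (sleDriving κ ω) z →
      sleDerivRatio κ ω z t ≤ Z := fun t ht ↦ hmono.ge_of_tendsto hZ ⟨t, ht⟩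
  -- `Z ≥ 1 > 0` (the ratio is `1` at time `0 < τ(z)`)
  have hzW : z ≠ sleDriving κ ω 0 := by
    intro h
    have : z.im = 0 := by rw [h, Complex.ofReal_im]
    exact hz.ne' this
  have h0 : ((0 : ℝ≥0) : WithTop ℝ≥0) < Loewner.swallowingTime (sleDriving κ ω) z :=
    Loewner.swallowingTime_pos_holds hW hzW
  have hZ1 : 1 ≤ Z := by
    have := hle 0 h0
    rwa [sleDerivRatio_zero κ ω hz] at this
  have hZ0 : 0 < Z := one_pos.trans_le hZ1
  refine hg.notMem_range_of_ball_subset_domain hW hz (ρ := z.im / (64 * π * Z)) (by positivity)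
    fun t ht ↦ ?_
  exact Loewner.ball_subset_domain_of_ratio_le hW hz ht (hle t ht)

section CritPerc

/-- **Rohde–Schramm (2005), Thm 6.4, first half, from its printed lemmas**: the named fact
`ae_isSwallowed_sleTrace` (for `4 < κ < 8` and `z ∈ closure ℍ ∖ {0}`, a.s. `z ∉ γ[0, ∞)` and
`τ(z) < ∞`) follows from the existence of the trace (`hasSLETrace_of_ne_eight`, RS05 Thm 5.1,
hypothesis `hT`), Lemma 6.5 (`ae_swallowingTime_lt_top_of_four_lt`, `h65`), Lemma 6.3 for
`κ < 8` (`exists_tendsto_sleDerivRatio_of_lt_eight`, `h63`) and the first-hit consequence of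
Lemma 6.6 (`ae_sleTrace_firstHit_realRay_ne`, `hX`; see the honesty note there: for real points
only the topology is reduced); eq. (6.2) (Koebe) and all topology are proved
(`notMem_range_sleTrace_of_tendsto_sleDerivRatio`, `ae_ofReal_notMem_range_sleTrace_of_firstHit_ne`).
Printed proof, p. 908: "Suppose that `κ ∈ (4, 8)` and `z ∈ closure ℍ`. Lemma 6.5 shows that
`z ∈ ⋃ₜ Kₜ` a.s. If `z ∈ ℍ`, then Lemma 6.3 and (6.2) show a.s. `z ∉ γ[0, ∞)`. Lemma 6.6 shows
that `1 ∉ γ[0, ∞)` a.s., and the same follows for every `z ∈ ℝ ∖ {0}` by scale and reflection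
invariance." [cite: RohdeSchramm2005, Thm 6.4] -/
theorem ae_isSwallowed_sleTrace_of_lemmas (hT : hasSLETrace_of_ne_eight)
    (h65 : ae_swallowingTime_lt_top_of_four_lt) (h63 : exists_tendsto_sleDerivRatio_of_lt_eight)
    (hX : ae_sleTrace_firstHit_realRay_ne) : ae_isSwallowed_sleTrace := by
  intro κ hκ hκ' z hzim hz0
  rcases hzim.eq_or_lt with him | him
  · -- real point `z = x`, `x ≠ 0`
    have hre : z.re ≠ 0 := fun h ↦ hz0 (Complex.ext h him.symm)
    have hz : ((z.re : ℝ) : ℂ) = z := Complex.ext rfl (by rw [Complex.ofReal_im]; exact him)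
    filter_upwards [h65 hκ hzim hz0,
      ae_ofReal_notMem_range_sleTrace_of_firstHit_ne hT hX hκ hκ' hre] with ω h₁ h₂
    exact ⟨hz ▸ h₂, h₁⟩
  · -- interior point
    have hκ0 : 0 < κ := lt_trans (by norm_num) hκ
    filter_upwards [h65 hκ hzim hz0, h63 hκ0 hκ' z him,
      ae_isGeneratedByCurve_sleTrace (hT hκ'.ne)] with ω h₁ h₂ hg
    obtain ⟨Z, hZ⟩ := h₂
    exact ⟨notMem_range_sleTrace_of_tendsto_sleDerivRatio hg him hZ, h₁⟩

/-- **crit-perc.S20, self-touching phase, from the printed lemmas**: `ae_isSelfTouching_sleTrace`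
(for `4 < κ < 8` the SLE_κ trace is a.s. not injective with range of empty interior) follows from
the non-simplicity statement of Rohde–Schramm §1 (`ae_not_injective_sleTrace`, `hA`), the
existence of the trace (RS05 Thm 5.1, `hT`), Lemma 6.5 (`h65`), Lemma 6.3 for `κ < 8` (`h63`) and
the first-hit consequence of Lemma 6.6 (`hX`), through `ae_isSwallowed_sleTrace_of_lemmas` and
`ae_isSelfTouching_sleTrace_of`. [cite: RohdeSchramm2005, §1 p. 885 and Thm 6.4] -/
theorem ae_isSelfTouching_sleTrace_of_lemmas {κ : ℝ≥0} (hA : ae_not_injective_sleTrace)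
    (hT : hasSLETrace_of_ne_eight) (h65 : ae_swallowingTime_lt_top_of_four_lt)
    (h63 : exists_tendsto_sleDerivRatio_of_lt_eight) (hX : ae_sleTrace_firstHit_realRay_ne) :
    ae_isSelfTouching_sleTrace (κ := κ) :=
  ae_isSelfTouching_sleTrace_of hA (ae_isSwallowed_sleTrace_of_lemmas hT h65 h63 hX)

end CritPerc

end Literature.Probability.RandomPlanarGeometry
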